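import Mathlib
import HarnessLib
import Literature.Probability.Percolation.Percolation
import Literature.Probability.Percolation.BondPercolationSymmetry
import Literature.Probability.Percolation.SiteConnectionTools
import Literature.Probability.Percolation.UniquenessInfiniteCluster
import Literature.Probability.LatticeModels.LatticeGraph
import Literature.Probability.LatticeModels.ThermodynamicLimit
import Summits.CriticalPhenomena.PercolationContinuityZ3.Theorems.PercTreeValueTetrahedronLogConvexityCertDefs

/-!
# Mirror equivariance of the two-seed certificate (support stub `stub_mirrorCS`, part 1)

Crux `TetrahedronLogConvexity` (stmt-CriticalPhenomena-7801), line `Sketch` (certificate form).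
The objects are those of `PercTreeValueTetrahedronLogConvexityCertDefs.lean`: the open lattice
graph `latOpen ω`, the truncated merge layer `NR r R`, the merge event `AR r R`, the window
`edgeWindow r R`, the examined edges `explored r R ω` and the hybrid configuration `hyb r R`.

For a lattice automorphism `φ : ℤ³ ≃g ℤ³` (later: the coordinate swap `θ = (x₀ x₁)` of
`…Reflection.lean`, which fixes `0` and `a_r` and swaps `b_r ↔ c_r`), the relabelling
`ω ↦ φ '' ω` of bond configurations (`BondConfig.relabel (sym2Equiv φ)`)
* is an isomorphism of open lattice graphs `latOpen ω ≃g latOpen (φ '' ω)`, hence preserves open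
  lattice distances (`mirror_latOpen_edist`; a graph isomorphism preserves `SimpleGraph.edist`,
  `mirror_edist_iso`);
* if `φ` fixes `0` and `a_r`: leaves the truncated merge layer `NR` and the merge event `A_R`
  invariant (`mirror_NR_relabel`, `mirror_mem_AR_relabel`);
* if moreover `φ` preserves the window box: maps examined edges onto examined edges
  (`mirror_mem_explored_iff`) and therefore commutes with the hybrid,
  `hyb (φ '' ω, φ '' ω') = φ '' hyb (ω, ω')` (`mirror_hyb_relabel`).
Pure combinatorics (no measure); the probabilistic consequences are in part 2
(`…MirrorCS.lean`).
-/

noncomputable section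

open MeasureTheory
open Literature.Probability.Percolation Literature.Probability.LatticeModels

namespace Summit.CriticalPhenomena.PercolationContinuityZ3.Theorems.TetrahedronLogConvexity.Cert

/-! ### Graph distance under homomorphisms and isomorphisms -/

/-- A graph homomorphism does not increase the extended graph distance (map a geodesic). [folklore] -/
theorem mirror_edist_hom_le {V W : Type*} {G : SimpleGraph V} {G' : SimpleGraph W} (f : G →g G')
    (u v : V) : G'.edist (f u) (f v) ≤ G.edist u v := by
  by_cases h : G.edist u v = ⊤
  · rw [h]
    exact le_top
  · obtain ⟨p, hp⟩ := SimpleGraph.exists_walk_of_edist_ne_top h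
    rw [← hp, ← SimpleGraph.Walk.length_map f p]
    exact SimpleGraph.edist_le _

/-- A graph isomorphism preserves the extended graph distance. [folklore] -/
theorem mirror_edist_iso {V W : Type*} {G : SimpleGraph V} {G' : SimpleGraph W} (φ : G ≃g G')
    (u v : V) : G'.edist (φ u) (φ v) = G.edist u v := by
  refine le_antisymm (mirror_edist_hom_le φ.toHom u v) ?_
  have h := mirror_edist_hom_le φ.symm.toHom (φ u) (φ v)
  simp only [RelEmbedding.coe_toRelHom, RelIso.coe_toRelEmbedding, RelIso.symm_apply_apply] at h
  exact h

/-! ### The relabelled open lattice graph -/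

/-- Adjacency of the open lattice graph is transported by a lattice automorphism:
`φ x ∼ φ y` in `latOpen (φ '' ω)` iff `x ∼ y` in `latOpen ω`. [folklore] -/
theorem mirror_latOpen_adj_iff (φ : zdGraph 3 ≃g zdGraph 3) (ω : BondConfig (Site 3)) (x y : Site 3) :
    (latOpen (BondConfig.relabel (sym2Equiv φ.toEquiv) ω)).Adj (φ.toEquiv x) (φ.toEquiv y) ↔
      (latOpen ω).Adj x y := by
  unfold latOpen
  rw [SimpleGraph.inf_adj, SimpleGraph.inf_adj, openGraph_relabel_adj_iff, φ.map_rel_iff']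

/-- Open lattice distances are transported by a lattice automorphism:
`d_{φ '' ω}(φ x, φ y) = d_ω(x, y)`. [folklore] -/
theorem mirror_latOpen_edist (φ : zdGraph 3 ≃g zdGraph 3) (ω : BondConfig (Site 3)) (x y : Site 3) :
    (latOpen (BondConfig.relabel (sym2Equiv φ.toEquiv) ω)).edist (φ.toEquiv x) (φ.toEquiv y) =
      (latOpen ω).edist x y :=
  mirror_edist_iso (G := latOpen ω) (G' := latOpen (BondConfig.relabel (sym2Equiv φ.toEquiv) ω))
    ⟨φ.toEquiv, fun {a b} => mirror_latOpen_adj_iff φ ω a b⟩ x y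

/-! ### Invariance of the merge layer and of the merge event -/

/-- A lattice automorphism fixing the seeds `0, a_r` preserves the open distance between them. [folklore] -/
theorem mirror_edist_seeds (φ : zdGraph 3 ≃g zdGraph 3) (h0 : φ.toEquiv 0 = 0)
    {r : ℕ} (hA : φ.toEquiv (vA r) = vA r) (ω : BondConfig (Site 3)) :
    (latOpen (BondConfig.relabel (sym2Equiv φ.toEquiv) ω)).edist 0 (vA r) = (latOpen ω).edist 0 (vA r) := by
  have h := mirror_latOpen_edist φ ω 0 (vA r)
  rwa [h0, hA] at h

/-- **`NR` is invariant** under a lattice automorphism fixing the seeds: the defining predicate of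
the `Nat.find` only involves `d_ω(0, a_r)`. [folklore] -/
theorem mirror_NR_relabel (φ : zdGraph 3 ≃g zdGraph 3) (h0 : φ.toEquiv 0 = 0)
    {r : ℕ} (hA : φ.toEquiv (vA r) = vA r) (R : ℕ) (ω : BondConfig (Site 3)) :
    NR r R (BondConfig.relabel (sym2Equiv φ.toEquiv) ω) = NR r R ω := by
  classical
  unfold NR
  simp only [mirror_edist_seeds φ h0 hA ω]

/-- **`A_R` is invariant** under a lattice automorphism fixing the seeds. [folklore] -/
theorem mirror_mem_AR_relabel (φ : zdGraph 3 ≃g zdGraph 3) (h0 : φ.toEquiv 0 = 0)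
    {r : ℕ} (hA : φ.toEquiv (vA r) = vA r) (R : ℕ) (ω : BondConfig (Site 3)) :
    BondConfig.relabel (sym2Equiv φ.toEquiv) ω ∈ AR r R ↔ ω ∈ AR r R := by
  rw [mem_AR_iff, mem_AR_iff, mirror_NR_relabel φ h0 hA]

/-! ### Equivariance of the window, the examined edges and the hybrid -/

/-- The window of lattice edges is invariant under a box-preserving lattice automorphism. [folklore] -/
theorem mirror_mem_edgeWindow_iff {r R : ℕ} (φ : zdGraph 3 ≃g zdGraph 3)
    (hbox : ∀ x, φ.toEquiv x ∈ box 3 (R + r + 1) ↔ x ∈ box 3 (R + r + 1)) (e : Sym2 (Site 3)) :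
    sym2Equiv φ.toEquiv e ∈ edgeWindow r R ↔ e ∈ edgeWindow r R := by
  classical
  simp only [edgeWindow, Finset.mem_filter, Finset.mem_sym2_iff, sym2Equiv_mem_edgeSet_iff φ]
  refine and_congr ?_ Iff.rfl
  rw [sym2Equiv_apply]
  constructor
  · intro h a ha
    exact (hbox a).1 (h _ (Sym2.mem_map.2 ⟨a, ha, rfl⟩))
  · intro h a ha
    obtain ⟨b, hb, rfl⟩ := Sym2.mem_map.1 ha
    exact (hbox b).2 (h b hb)

/-- **The examined edges are equivariant**: `φ e` is examined in `φ '' ω` iff `e` is examined in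
`ω` (for `φ` fixing the seeds and preserving the window box). [folklore] -/
theorem mirror_mem_explored_iff {r R : ℕ} (φ : zdGraph 3 ≃g zdGraph 3) (h0 : φ.toEquiv 0 = 0)
    (hA : φ.toEquiv (vA r) = vA r)
    (hbox : ∀ x, φ.toEquiv x ∈ box 3 (R + r + 1) ↔ x ∈ box 3 (R + r + 1))
    (ω : BondConfig (Site 3)) (e : Sym2 (Site 3)) :
    sym2Equiv φ.toEquiv e ∈ explored r R (BondConfig.relabel (sym2Equiv φ.toEquiv) ω) ↔
      e ∈ explored r R ω := by
  classical
  have key0 : ∀ y, (latOpen (BondConfig.relabel (sym2Equiv φ.toEquiv) ω)).edist 0 (φ.toEquiv y) =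
      (latOpen ω).edist 0 y := fun y => by
    have h := mirror_latOpen_edist φ ω 0 y
    rwa [h0] at h
  have keyA : ∀ y, (latOpen (BondConfig.relabel (sym2Equiv φ.toEquiv) ω)).edist (vA r) (φ.toEquiv y) =
      (latOpen ω).edist (vA r) y := fun y => by
    have h := mirror_latOpen_edist φ ω (vA r) y
    rwa [hA] at h
  simp only [explored, Finset.mem_filter]
  rw [mirror_mem_edgeWindow_iff φ hbox, mirror_NR_relabel φ h0 hA]
  refine and_congr_right fun _ => ?_
  constructor
  · rintro ⟨x, hx, h⟩
    rw [sym2Equiv_apply, Sym2.mem_map] at hx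
    obtain ⟨y, hy, rfl⟩ := hx
    rw [key0, keyA] at h
    exact ⟨y, hy, h⟩
  · rintro ⟨y, hy, h⟩
    refine ⟨φ.toEquiv y, ?_, ?_⟩
    · rw [sym2Equiv_apply, Sym2.mem_map]
      exact ⟨y, hy, rfl⟩
    · rw [key0, keyA]
      exact h

/-- Membership form of the equivariance of the examined edges:
`e ∈ explored (φ '' ω) ↔ φ⁻¹ e ∈ explored ω`. [folklore] -/
theorem mirror_mem_explored_relabel_iff {r R : ℕ} (φ : zdGraph 3 ≃g zdGraph 3) (h0 : φ.toEquiv 0 = 0)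
    (hA : φ.toEquiv (vA r) = vA r)
    (hbox : ∀ x, φ.toEquiv x ∈ box 3 (R + r + 1) ↔ x ∈ box 3 (R + r + 1))
    (ω : BondConfig (Site 3)) (e : Sym2 (Site 3)) :
    e ∈ explored r R (BondConfig.relabel (sym2Equiv φ.toEquiv) ω) ↔
      (sym2Equiv φ.toEquiv).symm e ∈ explored r R ω := by
  conv_lhs => rw [← (sym2Equiv φ.toEquiv).apply_symm_apply e]
  exact mirror_mem_explored_iff φ h0 hA hbox ω _

/-- **The hybrid is equivariant**: `hyb (φ '' ω, φ '' ω') = φ '' hyb (ω, ω')`. [folklore] -/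
theorem mirror_hyb_relabel {r R : ℕ} (φ : zdGraph 3 ≃g zdGraph 3) (h0 : φ.toEquiv 0 = 0)
    (hA : φ.toEquiv (vA r) = vA r)
    (hbox : ∀ x, φ.toEquiv x ∈ box 3 (R + r + 1) ↔ x ∈ box 3 (R + r + 1))
    (ω ω' : BondConfig (Site 3)) :
    hyb r R (BondConfig.relabel (sym2Equiv φ.toEquiv) ω, BondConfig.relabel (sym2Equiv φ.toEquiv) ω') =
      BondConfig.relabel (sym2Equiv φ.toEquiv) (hyb r R (ω, ω')) := by
  ext e
  simp only [mem_hyb_iff, BondConfig.mem_relabel_iff, mirror_mem_explored_relabel_iff φ h0 hA hbox]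

/-- Open connections are transported by relabelling: `φ '' ζ ∈ {φ x ↔ φ y} ↔ ζ ∈ {x ↔ y}`
(`reachable_relabel_iff`). [folklore] -/
theorem mirror_relabel_mem_openConn_iff (θ : Site 3 ≃ Site 3) (ζ : BondConfig (Site 3)) (x y : Site 3) :
    BondConfig.relabel (sym2Equiv θ) ζ ∈ openConn (θ x) (θ y) ↔ ζ ∈ openConn x y :=
  reachable_relabel_iff θ ζ x y

end Summit.CriticalPhenomena.PercolationContinuityZ3.Theorems.TetrahedronLogConvexity.Cert

end
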